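import Mathlib
import Literature.Geometry.Lorentzian.KerrSchildCoord
import Summits.FinalStateConjecture.FinalStateConjecture.Theorems.EIHFluxBalanceInertialRecessionLorentz

/-!
# Route ClusterCompleteness — `RecedingDopplerBudget`: rank-one sums over `η⁻¹`

Helper file for the support item `stmt-FinalStateConjecture-15025`
(`Summit.FinalStateConjecture.FinalStateConjecture.Theses.ClusterCompleteness.RecedingDopplerBudget`).

The item's background is the inline inverse-metric field
`G^{μν}(x) = η^{μν} − ∑ᵢ χᵢ(x) 2Hᵢ(qᵢ x) (Λᵢ ℓ♯ᵢ(qᵢ x))^μ (Λᵢ ℓ♯ᵢ(qᵢ x))^ν`, a sum of rank-one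
Kerr–Schild terms over `η⁻¹`. This file records the pointwise ALGEBRA of a general rank-one sum
`G = η⁻¹ − ∑ᵢ cᵢ Lᵢ ⊗ Lᵢ` that the Doppler-budget proof consumes:

* the contraction `∑ G^{μν} ξ_μ ζ_ν = η(ξ, ζ) − ∑ᵢ cᵢ (Lᵢ·ξ)(Lᵢ·ζ)`, symmetry, and the velocity
  components `ẋ^μ = ∑_ν G^{μν} ξ_ν` (`sum_sum_rankOne`, `rankOne_symm`, `velocity_zero_rankOne`,
  `velocity_succ_rankOne`);
* where at most ONE term is active (`cⱼ = 0` for `j ≠ k`), with `c_k ≥ 0` and `L_k` null: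
  a nonzero null covector has nonvanishing time component of its velocity
  (`velocity_zero_ne_zero_of_single`, the reverse Cauchy–Schwarz inequality of a Kerr–Schild
  cone: `dx⁰` is `G`-timelike) and its velocity is `η`-causal (`velocity_causal_of_single`:
  Kerr–Schild light cones lie inside the Minkowski cone, `η(ẋ, ẋ) = −c (L·ξ)² ≤ 0`).
-/

noncomputable section

open Literature.Geometry.Lorentzian Set Filter
open scoped Topology

namespace Summit.FinalStateConjecture.FinalStateConjecture.Theorems.RecedingDoppler

/-! ### Rank-one sums over `η⁻¹`: contraction, symmetry -/

section RankOne

variable {N : ℕ} {G : E4 → Fin 4 → Fin 4 → ℝ} {c : Fin N → E4 → ℝ} {L : Fin N → E4 → E4}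

/-- `∑_{μν} η(∂_μ, ∂_ν) ξ_μ ζ_ν = η(ξ, ζ)` (bilinearity; O'Neill 1983, Ch. 3, p. 55). [folklore] -/
theorem sum_sum_minkowski_basisVector (ξ ζ : E4) :
    ∑ μ, ∑ ν, Minkowski.bilin (E4.basisVector μ) (E4.basisVector ν) * ξ μ * ζ ν =
      Minkowski.bilin ξ ζ := by
  simp only [Minkowski.bilin_apply]
  simp [Fin.sum_univ_four, Fin.sum_univ_three]
  ring

/-- **Contraction of a rank-one sum**: for `G^{μν} = η^{μν} − ∑ᵢ cᵢ Lᵢ^μ Lᵢ^ν`,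
`∑ G^{μν} ξ_μ ζ_ν = η(ξ, ζ) − ∑ᵢ cᵢ (Lᵢ·ξ)(Lᵢ·ζ)` (Kerr–Schild 1965, §2, for one term).
[folklore] -/
theorem sum_sum_rankOne
    (hG : ∀ x μ ν, G x μ ν = Minkowski.bilin (E4.basisVector μ) (E4.basisVector ν) -
      ∑ i, c i x * L i x μ * L i x ν) (x ξ ζ : E4) :
    ∑ μ, ∑ ν, G x μ ν * ξ μ * ζ ν =
      Minkowski.bilin ξ ζ - ∑ i, c i x * (∑ μ, L i x μ * ξ μ) * (∑ ν, L i x ν * ζ ν) := by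
  have h1 : ∀ μ ν, G x μ ν * ξ μ * ζ ν =
      Minkowski.bilin (E4.basisVector μ) (E4.basisVector ν) * ξ μ * ζ ν -
        ∑ i, c i x * L i x μ * L i x ν * ξ μ * ζ ν := by
    intro μ ν
    rw [hG, sub_mul, sub_mul, Finset.sum_mul, Finset.sum_mul]
  have h2 : ∀ i, c i x * (∑ μ, L i x μ * ξ μ) * (∑ ν, L i x ν * ζ ν) =
      ∑ μ, ∑ ν, c i x * L i x μ * L i x ν * ξ μ * ζ ν := by
    intro i
    rw [Finset.mul_sum, Finset.sum_comm]
    refine Finset.sum_congr rfl fun ν _ ↦ ?_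
    rw [Finset.mul_sum, Finset.sum_mul]
    exact Finset.sum_congr rfl fun μ _ ↦ by ring
  simp only [h1, Finset.sum_sub_distrib, sum_sum_minkowski_basisVector, h2]
  congr 1
  symm
  rw [Finset.sum_comm]
  refine Finset.sum_congr rfl fun μ _ ↦ ?_
  rw [Finset.sum_comm]

/-- A rank-one sum over `η⁻¹` is symmetric. [folklore] -/
theorem rankOne_symm
    (hG : ∀ x μ ν, G x μ ν = Minkowski.bilin (E4.basisVector μ) (E4.basisVector ν) -
      ∑ i, c i x * L i x μ * L i x ν) (x : E4) (μ ν : Fin 4) : G x μ ν = G x ν μ := by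
  rw [hG, hG, Minkowski.bilin_symm]
  congr 1
  exact Finset.sum_congr rfl fun i _ ↦ by ring

/-- The velocity components `ẋ^μ = ∑_ν G^{μν} ξ_ν` of a rank-one sum:
`ẋ^μ = η^{μμ} ξ_μ − ∑ᵢ cᵢ Lᵢ^μ (Lᵢ·ξ)`, time component. [folklore] -/
theorem velocity_zero_rankOne
    (hG : ∀ x μ ν, G x μ ν = Minkowski.bilin (E4.basisVector μ) (E4.basisVector ν) -
      ∑ i, c i x * L i x μ * L i x ν) (x ξ : E4) :
    ∑ ν, G x 0 ν * ξ ν = -(ξ 0) - ∑ i, c i x * L i x 0 * (∑ ν, L i x ν * ξ ν) := by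
  have h := sum_sum_rankOne hG x (E4.basisVector 0) ξ
  have h0 : ∀ ν, ∑ μ, G x μ ν * (E4.basisVector 0 : E4) μ = G x 0 ν := fun ν ↦ by
    simp [E4.basisVector, PiLp.single_apply]
  have h1 : ∑ μ, ∑ ν, G x μ ν * (E4.basisVector 0 : E4) μ * ξ ν = ∑ ν, G x 0 ν * ξ ν := by
    rw [Finset.sum_comm]
    refine Finset.sum_congr rfl fun ν _ ↦ ?_
    rw [← h0 ν, Finset.sum_mul]
  have h2 : ∀ i, ∑ μ, L i x μ * (E4.basisVector 0 : E4) μ = L i x 0 := fun i ↦ by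
    simp [E4.basisVector, PiLp.single_apply]
  rw [← h1, h, minkowski_bilin_basisVector_zero_left]
  simp only [h2]

/-- The spatial velocity components of a rank-one sum: `ẋ^{i+1} = ξ_{i+1} − ∑ⱼ cⱼ Lⱼ^{i+1} (Lⱼ·ξ)`.
[folklore] -/
theorem velocity_succ_rankOne
    (hG : ∀ x μ ν, G x μ ν = Minkowski.bilin (E4.basisVector μ) (E4.basisVector ν) -
      ∑ i, c i x * L i x μ * L i x ν) (x ξ : E4) (k : Fin 3) :
    ∑ ν, G x k.succ ν * ξ ν = ξ k.succ - ∑ i, c i x * L i x k.succ * (∑ ν, L i x ν * ξ ν) := by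
  have h := sum_sum_rankOne hG x (E4.basisVector k.succ) ξ
  have h0 : ∀ ν, ∑ μ, G x μ ν * (E4.basisVector k.succ : E4) μ = G x k.succ ν := fun ν ↦ by
    simp [E4.basisVector, PiLp.single_apply]
  have h1 : ∑ μ, ∑ ν, G x μ ν * (E4.basisVector k.succ : E4) μ * ξ ν =
      ∑ ν, G x k.succ ν * ξ ν := by
    rw [Finset.sum_comm]
    refine Finset.sum_congr rfl fun ν _ ↦ ?_
    rw [← h0 ν, Finset.sum_mul]
  have h2 : ∀ i, ∑ μ, L i x μ * (E4.basisVector k.succ : E4) μ = L i x k.succ := fun i ↦ by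
    simp [E4.basisVector, PiLp.single_apply]
  have h3 : Minkowski.bilin (E4.basisVector k.succ) ξ = ξ k.succ := by
    rw [Minkowski.bilin_apply]
    simp [E4.basisVector, PiLp.single_apply, Fin.succ_ne_zero, Finset.sum_ite_eq']
  rw [← h1, h, h3]
  simp only [h2]

/-- With at most one active coefficient, a weighted sum collapses to the active term. [folklore] -/
theorem sum_mul_mul_eq_of_single {x : E4} (hone : ∀ i j, c i x ≠ 0 → c j x ≠ 0 → i = j)
    {k : Fin N} (hk : c k x ≠ 0) (A B : Fin N → ℝ) :
    ∑ i, c i x * A i * B i = c k x * A k * B k := by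
  refine Finset.sum_eq_single k (fun i _ hik ↦ ?_) (fun h ↦ (h (Finset.mem_univ k)).elim)
  have : c i x = 0 := by
    by_contra hi
    exact hik (hone i k hi hk)
  rw [this, zero_mul, zero_mul]

/-- With no active coefficient, a weighted sum vanishes. [folklore] -/
theorem sum_mul_mul_eq_zero_of_forall {x : E4} (h0 : ∀ i, c i x = 0) (A B : Fin N → ℝ) :
    ∑ i, c i x * A i * B i = 0 :=
  Finset.sum_eq_zero fun i _ ↦ by rw [h0 i, zero_mul, zero_mul]

/-- **Reverse Cauchy–Schwarz for a single Kerr–Schild cone.** For `G = η⁻¹ − ∑ᵢ cᵢ Lᵢ ⊗ Lᵢ` with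
nonnegative coefficients of which at most one is nonzero at `x`, the active `Lᵢ` being `η`-null, a
NONZERO covector `ξ` with `G(ξ, ξ) = 0` has `ẋ⁰ = ∑_ν G^{0ν} ξ_ν ≠ 0`: the covector `dx⁰` is
`G`-timelike (`G^{00} = −1 − c (L⁰)² < 0`), and a null covector `G`-orthogonal to a timelike one
vanishes (O'Neill 1983, Ch. 5, Lemma 5.26, for the Lorentzian form `G_x`). [folklore] -/
theorem velocity_zero_ne_zero_of_single
    (hG : ∀ x μ ν, G x μ ν = Minkowski.bilin (E4.basisVector μ) (E4.basisVector ν) -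
      ∑ i, c i x * L i x μ * L i x ν) {x ξ : E4} (hc : ∀ i, 0 ≤ c i x)
    (hL : ∀ i, c i x ≠ 0 → Minkowski.bilin (L i x) (L i x) = 0)
    (hone : ∀ i j, c i x ≠ 0 → c j x ≠ 0 → i = j)
    (hnull : ∑ μ, ∑ ν, G x μ ν * ξ μ * ξ ν = 0) (hξ : ξ ≠ 0) :
    ∑ ν, G x 0 ν * ξ ν ≠ 0 := by
  intro h0
  apply hξ
  rw [velocity_zero_rankOne hG] at h0
  rw [sum_sum_rankOne hG] at hnull
  -- components of `ξ`
  have hP : Minkowski.bilin ξ ξ = -(ξ 0) ^ 2 + (ξ 1 ^ 2 + ξ 2 ^ 2 + ξ 3 ^ 2) := by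
    rw [Minkowski.bilin_apply, Fin.sum_univ_three]
    simp only [Fin.succ_zero_eq_one, Fin.succ_one_eq_two]
    rw [show (2 : Fin 3).succ = (3 : Fin 4) from rfl]
    ring
  -- conclusion from `ξ 0 = 0` and `ξ₁² + ξ₂² + ξ₃² = 0`
  have hfin : ξ 0 = 0 → ξ 1 ^ 2 + ξ 2 ^ 2 + ξ 3 ^ 2 = 0 → ξ = 0 := by
    intro ha hb
    have h1 : ξ 1 = 0 := by nlinarith [sq_nonneg (ξ 1), sq_nonneg (ξ 2), sq_nonneg (ξ 3)]
    have h2 : ξ 2 = 0 := by nlinarith [sq_nonneg (ξ 1), sq_nonneg (ξ 2), sq_nonneg (ξ 3)]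
    have h3 : ξ 3 = 0 := by nlinarith [sq_nonneg (ξ 1), sq_nonneg (ξ 2), sq_nonneg (ξ 3)]
    ext μ
    fin_cases μ
    · exact ha
    · exact h1
    · exact h2
    · exact h3
  by_cases hex : ∃ k, c k x ≠ 0
  · obtain ⟨k, hk⟩ := hex
    rw [sum_mul_mul_eq_of_single hone hk] at h0
    have hnull' : Minkowski.bilin ξ ξ - c k x * (∑ μ, L k x μ * ξ μ) * (∑ ν, L k x ν * ξ ν) = 0 := by
      rw [← hnull, sum_mul_mul_eq_of_single hone hk]
    -- real variables
    set cc := c k x with hcc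
    have hcpos : 0 < cc := lt_of_le_of_ne (hc k) (Ne.symm hk)
    have hLk := hL k hk
    set m := ∑ μ, L k x μ * ξ μ with hm
    have hm' : m = L k x 0 * ξ 0 + (L k x 1 * ξ 1 + L k x 2 * ξ 2 + L k x 3 * ξ 3) := by
      rw [hm, Fin.sum_univ_four]; ring
    have hQ : Minkowski.bilin (L k x) (L k x) =
        -(L k x 0) ^ 2 + ((L k x 1) ^ 2 + (L k x 2) ^ 2 + (L k x 3) ^ 2) := by
      rw [Minkowski.bilin_apply, Fin.sum_univ_three]
      simp only [Fin.succ_zero_eq_one, Fin.succ_one_eq_two]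
      rw [show (2 : Fin 3).succ = (3 : Fin 4) from rfl]
      ring
    rw [hQ] at hLk
    rw [hP] at hnull'
    -- abbreviate
    set A := ξ 0
    set x1 := ξ 1
    set x2 := ξ 2
    set x3 := ξ 3
    set l0 := L k x 0
    set l1 := L k x 1
    set l2 := L k x 2
    set l3 := L k x 3
    -- `A = -cc l0 m`
    have hA : A = -(cc * l0 * m) := by linarith
    -- Lagrange: `D² ≤ Q P`
    have hCS : (l1 * x1 + l2 * x2 + l3 * x3) ^ 2 ≤
        (l1 ^ 2 + l2 ^ 2 + l3 ^ 2) * (x1 ^ 2 + x2 ^ 2 + x3 ^ 2) := by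
      nlinarith [sq_nonneg (l1 * x2 - l2 * x1), sq_nonneg (l1 * x3 - l3 * x1),
        sq_nonneg (l2 * x3 - l3 * x2)]
    have hD : l1 * x1 + l2 * x2 + l3 * x3 = m * (1 + cc * l0 ^ 2) := by
      linear_combination (-1 : ℝ) * hm' + (-l0) * hA
    have hPP : x1 ^ 2 + x2 ^ 2 + x3 ^ 2 = cc ^ 2 * l0 ^ 2 * m ^ 2 + cc * m ^ 2 := by
      linear_combination hnull' + (A - cc * l0 * m) * hA
    have hQQ : l1 ^ 2 + l2 ^ 2 + l3 ^ 2 = l0 ^ 2 := by linarith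
    rw [hD, hPP, hQQ] at hCS
    have hkey : m ^ 2 * (1 + cc * l0 ^ 2) ≤ 0 := by nlinarith [hCS, hcpos, sq_nonneg l0, sq_nonneg m]
    have hm0 : m = 0 := by
      by_contra hmne
      have : 0 < m ^ 2 * (1 + cc * l0 ^ 2) := by positivity
      linarith
    have hA0 : A = 0 := by rw [hA, hm0]; ring
    refine hfin hA0 ?_
    rw [hPP, hm0]; ring
  · push Not at hex
    rw [sum_mul_mul_eq_zero_of_forall hex] at h0
    have hnull' : Minkowski.bilin ξ ξ = 0 := by
      rw [← hnull, sum_mul_mul_eq_zero_of_forall hex]; ring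
    have hA0 : ξ 0 = 0 := by linarith
    refine hfin hA0 ?_
    rw [hP, hA0] at hnull'
    linarith

/-- **Kerr–Schild cones lie inside the Minkowski cone.** Under the same single-active-term
hypotheses, the velocity `ẋ^μ = ∑_ν G^{μν} ξ_ν` of a null covector is `η`-causal:
`∑_{i} (ẋ^{i})² ≤ (ẋ⁰)²` — indeed `η(ẋ, ẋ) = −c (L·ξ)² ≤ 0` (for `g = η + 2Hℓ⊗ℓ`,
`g(X,X) ≥ η(X,X)`; Kerr–Schild 1965, §2). [folklore] -/
theorem velocity_causal_of_single
    (hG : ∀ x μ ν, G x μ ν = Minkowski.bilin (E4.basisVector μ) (E4.basisVector ν) -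
      ∑ i, c i x * L i x μ * L i x ν) {x ξ : E4} (hc : ∀ i, 0 ≤ c i x)
    (hL : ∀ i, c i x ≠ 0 → Minkowski.bilin (L i x) (L i x) = 0)
    (hone : ∀ i j, c i x ≠ 0 → c j x ≠ 0 → i = j)
    (hnull : ∑ μ, ∑ ν, G x μ ν * ξ μ * ξ ν = 0) :
    ∑ k : Fin 3, (∑ ν, G x k.succ ν * ξ ν) ^ 2 ≤ (∑ ν, G x 0 ν * ξ ν) ^ 2 := by
  rw [velocity_zero_rankOne hG, Fin.sum_univ_three, velocity_succ_rankOne hG,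
    velocity_succ_rankOne hG, velocity_succ_rankOne hG]
  rw [sum_sum_rankOne hG] at hnull
  have hP : Minkowski.bilin ξ ξ = -(ξ 0) ^ 2 + (ξ 1 ^ 2 + ξ 2 ^ 2 + ξ 3 ^ 2) := by
    rw [Minkowski.bilin_apply, Fin.sum_univ_three]
    simp only [Fin.succ_zero_eq_one, Fin.succ_one_eq_two]
    rw [show (2 : Fin 3).succ = (3 : Fin 4) from rfl]
    ring
  simp only [Fin.succ_zero_eq_one, Fin.succ_one_eq_two]
  rw [show (2 : Fin 3).succ = (3 : Fin 4) from rfl]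
  by_cases hex : ∃ k, c k x ≠ 0
  · obtain ⟨k, hk⟩ := hex
    simp only [sum_mul_mul_eq_of_single hone hk]
    have hnull' : Minkowski.bilin ξ ξ - c k x * (∑ μ, L k x μ * ξ μ) * (∑ ν, L k x ν * ξ ν) = 0 := by
      rw [← hnull, sum_mul_mul_eq_of_single hone hk]
    have hLk := hL k hk
    set m := ∑ μ, L k x μ * ξ μ with hm
    have hm' : m = L k x 0 * ξ 0 + (L k x 1 * ξ 1 + L k x 2 * ξ 2 + L k x 3 * ξ 3) := by
      rw [hm, Fin.sum_univ_four]; ring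
    have hQ : Minkowski.bilin (L k x) (L k x) =
        -(L k x 0) ^ 2 + ((L k x 1) ^ 2 + (L k x 2) ^ 2 + (L k x 3) ^ 2) := by
      rw [Minkowski.bilin_apply, Fin.sum_univ_three]
      simp only [Fin.succ_zero_eq_one, Fin.succ_one_eq_two]
      rw [show (2 : Fin 3).succ = (3 : Fin 4) from rfl]
      ring
    rw [hQ] at hLk
    rw [hP] at hnull'
    have hcc := hc k
    have key : (-ξ 0 - c k x * L k x 0 * m) ^ 2 -
        ((ξ 1 - c k x * L k x 1 * m) ^ 2 + (ξ 2 - c k x * L k x 2 * m) ^ 2 +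
          (ξ 3 - c k x * L k x 3 * m) ^ 2) = c k x * m ^ 2 := by
      linear_combination (-1 : ℝ) * hnull' + (-2 * c k x * m) * hm' + (-(c k x) ^ 2 * m ^ 2) * hLk
    nlinarith [key, mul_nonneg hcc (sq_nonneg m)]
  · push Not at hex
    simp only [sum_mul_mul_eq_zero_of_forall hex]
    have hnull' : Minkowski.bilin ξ ξ = 0 := by
      rw [← hnull, sum_mul_mul_eq_zero_of_forall hex]; ring
    rw [hP] at hnull'
    nlinarith [hnull']

end RankOne

end Summit.FinalStateConjecture.FinalStateConjecture.Theorems.RecedingDoppler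

end
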